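import Literature.NumberTheory.LFunctions.PatelYangTopPhi
import Literature.NumberTheory.LFunctions.PatelYangMidPhi
import Literature.NumberTheory.LFunctions.GeometricBlocks
import HarnessLib

/-!
# Patel–Yang §3.4–3.5: summing the block bounds over the geometric block decomposition

Topic `Literature/NumberTheory/LFunctions`. Patel–Yang 2024, Lemma 3.5 (the top range
`θ₂t^{7/17} < n ≤ √(t/2π)`, blocks of ratio `ρ₁`) and Lemma 3.3 (the middle range, blocks of ratio
`ρ₂`): the per-block bounds `Literature.NumberTheory.LFunctions.VdC.topBlock_phi_le` and
`…midBlock_phi_le` are summed over the blocks `(a_{k+1}, a_k]`, `a_k = ⌊Y ρ^{-k}⌋`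
(`…GeometricBlocks`), the powers of the block starts being summed as geometric series. Everything
is PROVED; the `def`s below only name the (already explicit) coefficients.

## Main results

* `Literature.NumberTheory.LFunctions.VdC.topRange_sum_le` — PY Lemma 3.5 (our constants, infinite
  geometric sums, negative powers through `a ≥ θ₂t^{7/17}`).
* `Literature.NumberTheory.LFunctions.VdC.midRange_sum_le` — PY Lemma 3.3 summed (our constants).

## References

* D. Patel, A. Yang, *An explicit sub-Weyl bound for `ζ(1/2 + it)`*, J. Number Theory 262 (2024),
  Lemmas 3.3 and 3.5. [cite: PatelYang2024, Lemma 3.5]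
-/

noncomputable section

open Real Set

namespace Literature.NumberTheory.LFunctions
namespace VdC

/-! ### Names for the coefficients -/

/-- `α = √(h - 1 + θ₁θ₂^{-5/41}t₀^{-222/697})`. [cite: PatelYang2024, Lemma 3.4] -/
def pyAlpha (h θ₁ θ₂ t₀ : ℝ) : ℝ := Real.sqrt (h - 1 + θ₁ * θ₂ ^ (-(5 / 41 : ℝ)) * t₀ ^ (-(222 / 697 : ℝ)))

/-- `ω = (1 + q₀⁻¹)θ₁`, `q₀ = θ₁θ₂^{36/41}t₀^{65/697}`. [cite: PatelYang2024, Lemma 3.4] -/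
def pyOmega (θ₁ θ₂ t₀ : ℝ) : ℝ := (1 + (θ₁ * θ₂ ^ (36 / 41 : ℝ) * t₀ ^ (65 / 697 : ℝ))⁻¹) * θ₁

/-- `√κ₁`. [cite: PatelYang2024, Lemma 3.4] -/
def pySK1 (h η θ₁ θ₂ t₀ : ℝ) : ℝ :=
  Real.sqrt ((h - 1) * θ₁⁻¹ + 1800 / 2911 * (3 / Real.sqrt 2 * (h * Real.sqrt h)
    * yangA η (h ^ 13) 5 * (h ^ 13) ^ (1 / 8 : ℝ) * (2 * (h - 1)) * (105 / 16 / h ^ 2) ^ (1 / 30 : ℝ))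
    * (2 * π) ^ (-(11 / 30 : ℝ)) * (pyOmega θ₁ θ₂ t₀) ^ (11 / 30 : ℝ))

/-- `√κ₂`. [cite: PatelYang2024, Lemma 3.4] -/
def pySK2 (h η θ₁ θ₂ t₀ : ℝ) : ℝ :=
  Real.sqrt (28800 / 54481 * (3 / Real.sqrt 2 * (h * Real.sqrt h) * yangB η 5
    * (2 * (h - 1)) ^ (7 / 8 : ℝ) * ((105 / 16 / h ^ 2) ^ (1 / 30 : ℝ))⁻¹)
    * (2 * π) ^ (-(61 / 120 : ℝ)) * (pyOmega θ₁ θ₂ t₀) ^ (61 / 120 : ℝ))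

/-- `√κ₀`. [cite: PatelYang2024, Lemma 3.4] -/
def pySK0 (h θ₁ : ℝ) : ℝ :=
  Real.sqrt (8 / 3 * ((3 + 50 * h ^ 8) / Real.sqrt 2 * (h * Real.sqrt h)) * (2 * π) ^ (1 / 2 : ℝ) * θ₁ ^ (-(1 / 2 : ℝ)))

/-- `√κ₃`. [cite: PatelYang2024, Lemma 3.4] -/
def pySK3 (h : ℝ) : ℝ := Real.sqrt (2 * (50 * h ^ 8 * (Real.log 2 + 3)))

/-- `√κ₄`. [cite: PatelYang2024, Lemma 3.4] -/
def pySK4 (h θ₁ θ₂ t₀ : ℝ) : ℝ :=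
  Real.sqrt (9 / 14 * (50 * h ^ 8 * 3 * ((h - 1) / h ^ 3) ^ (1 / 3 : ℝ)) * (2 * π) ^ (-(1 / 3 : ℝ))
    * (pyOmega θ₁ θ₂ t₀) ^ (1 / 3 : ℝ))

/-- `√κ₅`. [cite: PatelYang2024, Lemma 3.4] -/
def pySK5 (h θ₁ θ₂ t₀ : ℝ) : ℝ :=
  Real.sqrt (25 / 42 * (50 * h ^ 8 * (h - 1) * (12 / h ^ 7) ^ (1 / 5 : ℝ)) * (2 * π) ^ (-(2 / 5 : ℝ))
    * (pyOmega θ₁ θ₂ t₀) ^ (2 / 5 : ℝ))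

/-- `D₃ = A₄(η,h⁴)(h-1)h^{5/7}(3/π)^{1/14}`. [cite: PatelYang2024, Lemma 3.3] -/
def pyD3 (h η : ℝ) : ℝ := yangA η (h ^ 4) 4 * (h - 1) * h ^ (5 / 7 : ℝ) * (3 / π) ^ (1 / 14 : ℝ)

/-- `D₄ = B₄(η)(h-1)^{3/4}h^{2/7}(3/π)^{-1/14}`. [cite: PatelYang2024, Lemma 3.3] -/
def pyD4 (h η : ℝ) : ℝ := yangB η 4 * (h - 1) ^ (3 / 4 : ℝ) * h ^ (2 / 7 : ℝ) * (3 / π) ^ (-(1 / 14 : ℝ))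

/-- `α ≥ 0`. [folklore] -/
theorem pyAlpha_nonneg (h θ₁ θ₂ t₀ : ℝ) : 0 ≤ pyAlpha h θ₁ θ₂ t₀ := Real.sqrt_nonneg _
/-- `√κ₁ ≥ 0`. [folklore] -/
theorem pySK1_nonneg (h η θ₁ θ₂ t₀ : ℝ) : 0 ≤ pySK1 h η θ₁ θ₂ t₀ := Real.sqrt_nonneg _
/-- `√κ₂ ≥ 0`. [folklore] -/
theorem pySK2_nonneg (h η θ₁ θ₂ t₀ : ℝ) : 0 ≤ pySK2 h η θ₁ θ₂ t₀ := Real.sqrt_nonneg _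
/-- `√κ₀ ≥ 0`. [folklore] -/
theorem pySK0_nonneg (h θ₁ : ℝ) : 0 ≤ pySK0 h θ₁ := Real.sqrt_nonneg _
/-- `√κ₃ ≥ 0`. [folklore] -/
theorem pySK3_nonneg (h : ℝ) : 0 ≤ pySK3 h := Real.sqrt_nonneg _
/-- `√κ₄ ≥ 0`. [folklore] -/
theorem pySK4_nonneg (h θ₁ θ₂ t₀ : ℝ) : 0 ≤ pySK4 h θ₁ θ₂ t₀ := Real.sqrt_nonneg _
/-- `√κ₅ ≥ 0`. [folklore] -/
theorem pySK5_nonneg (h θ₁ θ₂ t₀ : ℝ) : 0 ≤ pySK5 h θ₁ θ₂ t₀ := Real.sqrt_nonneg _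

/-- `D₃ ≥ 0` (`h > 1`, `η > 0`). [folklore] -/
theorem pyD3_nonneg {h η : ℝ} (hh : 1 < h) (hη : 0 < η) : 0 ≤ pyD3 h η := by
  unfold pyD3
  have := yangA_pos hη (one_le_pow₀ hh.le : 1 ≤ h ^ 4) 4 (by norm_num)
  have : 0 ≤ h - 1 := by linarith
  have : 0 < h := by linarith
  positivity

/-- `D₄ ≥ 0` (`h > 1`, `η > 0`). [folklore] -/
theorem pyD4_nonneg {h η : ℝ} (hh : 1 < h) (hη : 0 < η) : 0 ≤ pyD4 h η := by
  unfold pyD4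
  have := yangB_pos hη 4 (by norm_num)
  have : 0 ≤ h - 1 := by linarith
  have : 0 < h := by linarith
  positivity

/-- `topBlock_phi_le` with the named coefficients. [cite: PatelYang2024, Lemma 3.4] -/
theorem topBlock_phi_le' {t t₀ h η θ₁ θ₂ : ℝ} (ht₀ : 0 < t₀) (ht : t₀ ≤ t) (hh1 : 1 < h) (hη : 0 < η)
    (hθ₁ : 0 < θ₁) (hθ₂ : 0 < θ₂) {a b : ℕ} (ha : 1 ≤ a) (haθ : θ₂ * t ^ (7 / 17 : ℝ) ≤ a)
    (hb : (b : ℝ) ≤ h * a) :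
    ‖∑ n ∈ Finset.Ioc a b, (n : ℂ) ^ (-((1 / 2 : ℂ) + t * Complex.I))‖
      ≤ pyAlpha h θ₁ θ₂ t₀ *
        (pySK1 h η θ₁ θ₂ t₀ * (a : ℝ) ^ (5 / 82 : ℝ) * t ^ (11 / 82 : ℝ)
        + pySK2 h η θ₁ θ₂ t₀ * (a : ℝ) ^ (-(17 / 328 : ℝ)) * t ^ (61 / 328 : ℝ)
        + pySK0 h θ₁ * (a : ℝ) ^ (87 / 164 : ℝ) * t ^ (-(15 / 82 : ℝ))
        + pySK3 h
        + pySK4 h θ₁ θ₂ t₀ * (a : ℝ) ^ (-(23 / 123 : ℝ)) * t ^ (5 / 41 : ℝ)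
        + pySK5 h θ₁ θ₂ t₀ * (a : ℝ) ^ (-(1 / 41 : ℝ)) * t ^ (6 / 41 : ℝ)) := by
  have h := topBlock_phi_le ht₀ ht hh1 hη hθ₁ hθ₂ ha haθ hb
  unfold pyAlpha pySK1 pySK2 pySK0 pySK3 pySK4 pySK5 pyOmega
  exact h

/-- `midBlock_phi_le` with the named coefficients. [cite: PatelYang2024, Lemma 3.3] -/
theorem midBlock_phi_le' {t h η : ℝ} (ht : 0 < t) (hh1 : 1 < h) (hη : 0 < η) {a b : ℕ}
    (ha : 1 ≤ a) (hb : (b : ℝ) ≤ h * a) :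
    ‖∑ n ∈ Finset.Ioc a b, (n : ℂ) ^ (-((1 / 2 : ℂ) + t * Complex.I))‖
      ≤ pyD3 h η * (a : ℝ) ^ (3 / 14 : ℝ) * t ^ (1 / 14 : ℝ)
        + pyD4 h η * (a : ℝ) ^ (15 / 28 : ℝ) * t ^ (-(1 / 14 : ℝ)) := by
  have h := midBlock_phi_le (η := η) ht hh1 hη ha hb
  unfold pyD3 pyD4
  exact h

/-! ### The top range (Patel–Yang, Lemma 3.5) -/

set_option maxHeartbeats 400000 in
/-- **The top range summed over its blocks** (Patel–Yang Lemma 3.5, our constants): with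
`x₀ = √(t/2π)`, `Z = θ₂t^{7/17} + 1 ≤ x₀`, `K = ⌊log(x₀/Z)/log ρ⌋`, `a_k = ⌊x₀ρ^{-k}⌋` and
`ρ(1 + 1/(θ₂t^{7/17})) ≤ H`:
`‖∑_{a_K<n≤a_0} n^{-(1/2+it)}‖ ≤ α(√κ₁ t^{11/82} x₀^{5/82}/(ρ^{5/82}-1) + √κ₂ t^{61/328}(θ₂t^{7/17})^{-17/328}/(1-ρ^{-17/328})
 + √κ₀ t^{-15/82}x₀^{87/164}/(ρ^{87/164}-1) + √κ₃ K + √κ₄ t^{5/41}(θ₂t^{7/17})^{-23/123}/(1-ρ^{-23/123})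
 + √κ₅ t^{6/41}(θ₂t^{7/17})^{-1/41}/(1-ρ^{-1/41}))` (coefficients at `h = H`).
[cite: PatelYang2024, Lemma 3.5] -/
theorem topRange_sum_le {t t₀ ρ H η θ₁ θ₂ : ℝ} (ht₀ : 0 < t₀) (ht : t₀ ≤ t) (hρ : 1 < ρ)
    (hH : ρ * (1 + 1 / (θ₂ * t ^ (7 / 17 : ℝ))) ≤ H) (hη : 0 < η) (hθ₁ : 0 < θ₁) (hθ₂ : 0 < θ₂)
    (hZ1 : 1 ≤ θ₂ * t ^ (7 / 17 : ℝ))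
    (hZx : θ₂ * t ^ (7 / 17 : ℝ) + 1 ≤ Real.sqrt (t / (2 * π))) :
    ‖∑ n ∈ Finset.Ioc
        (geomBlock (Real.sqrt (t / (2 * π))) ρ
          ⌊Real.log (Real.sqrt (t / (2 * π)) / (θ₂ * t ^ (7 / 17 : ℝ) + 1)) / Real.log ρ⌋₊)
        (geomBlock (Real.sqrt (t / (2 * π))) ρ 0), (n : ℂ) ^ (-((1 / 2 : ℂ) + t * Complex.I))‖
      ≤ pyAlpha H θ₁ θ₂ t₀ *
        (pySK1 H η θ₁ θ₂ t₀ * t ^ (11 / 82 : ℝ) * ((Real.sqrt (t / (2 * π))) ^ (5 / 82 : ℝ) / (ρ ^ (5 / 82 : ℝ) - 1))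
        + pySK2 H η θ₁ θ₂ t₀ * t ^ (61 / 328 : ℝ)
            * ((θ₂ * t ^ (7 / 17 : ℝ)) ^ (-(17 / 328 : ℝ)) / (1 - ρ ^ (-(17 / 328 : ℝ))))
        + pySK0 H θ₁ * t ^ (-(15 / 82 : ℝ)) * ((Real.sqrt (t / (2 * π))) ^ (87 / 164 : ℝ) / (ρ ^ (87 / 164 : ℝ) - 1))
        + pySK3 H * ⌊Real.log (Real.sqrt (t / (2 * π)) / (θ₂ * t ^ (7 / 17 : ℝ) + 1)) / Real.log ρ⌋₊
        + pySK4 H θ₁ θ₂ t₀ * t ^ (5 / 41 : ℝ)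
            * ((θ₂ * t ^ (7 / 17 : ℝ)) ^ (-(23 / 123 : ℝ)) / (1 - ρ ^ (-(23 / 123 : ℝ))))
        + pySK5 H θ₁ θ₂ t₀ * t ^ (6 / 41 : ℝ)
            * ((θ₂ * t ^ (7 / 17 : ℝ)) ^ (-(1 / 41 : ℝ)) / (1 - ρ ^ (-(1 / 41 : ℝ))))) := by
  have ht0 : 0 < t := ht₀.trans_le ht
  set x₀ : ℝ := Real.sqrt (t / (2 * π)) with hx₀
  set Zθ : ℝ := θ₂ * t ^ (7 / 17 : ℝ) with hZθ
  set K : ℕ := ⌊Real.log (x₀ / (Zθ + 1)) / Real.log ρ⌋₊ with hK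
  have hx₀0 : 0 ≤ x₀ := Real.sqrt_nonneg _
  have hZθ0 : 0 < Zθ := by positivity
  have hρ1 : 1 ≤ ρ := hρ.le
  -- the boundary `y_K ≥ Zθ + 1`
  have hyK : Zθ + 1 ≤ geomSeq x₀ ρ K := geomSeq_floorLog_ge (by linarith) hZx hρ
  have hyK1 : 1 < geomSeq x₀ ρ K := by linarith
  have hH1 : 1 < H := by
    have : 1 < ρ * (1 + 1 / Zθ) := by
      have h1 : 0 < 1 / Zθ := by positivity
      nlinarith
    linarith
  -- per-block bounds
  set α := pyAlpha H θ₁ θ₂ t₀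
  set S1 := pySK1 H η θ₁ θ₂ t₀
  set S2 := pySK2 H η θ₁ θ₂ t₀
  set S0 := pySK0 H θ₁
  set S3 := pySK3 H
  set S4 := pySK4 H θ₁ θ₂ t₀
  set S5 := pySK5 H θ₁ θ₂ t₀
  have hα := pyAlpha_nonneg H θ₁ θ₂ t₀
  have hS1 := pySK1_nonneg H η θ₁ θ₂ t₀
  have hS2 := pySK2_nonneg H η θ₁ θ₂ t₀
  have hS0 := pySK0_nonneg H θ₁
  have hS3 := pySK3_nonneg H
  have hS4 := pySK4_nonneg H θ₁ θ₂ t₀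
  have hS5 := pySK5_nonneg H θ₁ θ₂ t₀
  have hblock : ∀ k ∈ Finset.range K,
      ‖∑ n ∈ Finset.Ioc (geomBlock x₀ ρ (k + 1)) (geomBlock x₀ ρ k), (n : ℂ) ^ (-((1 / 2 : ℂ) + t * Complex.I))‖
        ≤ α * S1 * t ^ (11 / 82 : ℝ) * (geomBlock x₀ ρ (k + 1) : ℝ) ^ (5 / 82 : ℝ)
          + α * S2 * t ^ (61 / 328 : ℝ) * (geomBlock x₀ ρ (k + 1) : ℝ) ^ (-(17 / 328 : ℝ))
          + α * S0 * t ^ (-(15 / 82 : ℝ)) * (geomBlock x₀ ρ (k + 1) : ℝ) ^ (87 / 164 : ℝ)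
          + α * S3
          + α * S4 * t ^ (5 / 41 : ℝ) * (geomBlock x₀ ρ (k + 1) : ℝ) ^ (-(23 / 123 : ℝ))
          + α * S5 * t ^ (6 / 41 : ℝ) * (geomBlock x₀ ρ (k + 1) : ℝ) ^ (-(1 / 41 : ℝ)) := by
    intro k hk
    rw [Finset.mem_range] at hk
    have hage : geomSeq x₀ ρ K - 1 ≤ geomBlock x₀ ρ (k + 1) := geomBlock_succ_ge hx₀0 hρ1 hk
    have haθ : Zθ ≤ geomBlock x₀ ρ (k + 1) := by linarith
    have ha1 : 1 ≤ geomBlock x₀ ρ (k + 1) := by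
      have : (1 : ℝ) ≤ geomBlock x₀ ρ (k + 1) := hZ1.trans haθ
      exact_mod_cast this
    have hratio := geomBlock_ratio_le hx₀0 hρ1 hk hyK1
    have hb : (geomBlock x₀ ρ k : ℝ) ≤ H * geomBlock x₀ ρ (k + 1) := by
      refine hratio.trans (mul_le_mul_of_nonneg_right ?_ (Nat.cast_nonneg _))
      refine le_trans ?_ hH
      refine mul_le_mul_of_nonneg_left ?_ (by linarith)
      have : 1 / (geomSeq x₀ ρ K - 1) ≤ 1 / Zθ :=
        one_div_le_one_div_of_le hZθ0 (by linarith)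
      linarith
    have h := topBlock_phi_le' (η := η) ht₀ ht hH1 hη hθ₁ hθ₂ ha1 haθ hb
    refine h.trans (le_of_eq ?_)
    ring
  refine (norm_sum_Ioc_telescope_le _ (fun k => geomBlock_antitone hx₀0 hρ1 (Nat.le_succ k)) K).trans ?_
  refine (Finset.sum_le_sum hblock).trans ?_
  simp only [Finset.sum_add_distrib, ← Finset.mul_sum, Finset.sum_const, Finset.card_range, nsmul_eq_mul]
  -- the geometric sums
  have g1 := sum_geomBlock_rpow_le_of_pos (x := 5 / 82) hx₀0 hρ (by norm_num) K
  have g0 := sum_geomBlock_rpow_le_of_pos (x := 87 / 164) hx₀0 hρ (by norm_num) K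
  have g2 := sum_geomBlock_rpow_le_of_neg (x := -(17 / 328)) hx₀0 hρ (by norm_num) hyK1
  have g4 := sum_geomBlock_rpow_le_of_neg (x := -(23 / 123)) hx₀0 hρ (by norm_num) hyK1
  have g5 := sum_geomBlock_rpow_le_of_neg (x := -(1 / 41)) hx₀0 hρ (by norm_num) hyK1
  -- `(y_K - 1)^x ≤ Zθ^x` for `x < 0`
  have hyθ : ∀ x : ℝ, x ≤ 0 → (geomSeq x₀ ρ K - 1) ^ x ≤ Zθ ^ x := fun x hx =>
    Real.rpow_le_rpow_of_nonpos hZθ0 (by linarith) hx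
  have hden : ∀ x : ℝ, x < 0 → 0 < 1 - ρ ^ x := fun x hx => by
    have : ρ ^ x < 1 := Real.rpow_lt_one_of_one_lt_of_neg hρ hx
    linarith
  have g2' : ∑ k ∈ Finset.range K, (geomBlock x₀ ρ (k + 1) : ℝ) ^ (-(17 / 328 : ℝ))
      ≤ Zθ ^ (-(17 / 328 : ℝ)) / (1 - ρ ^ (-(17 / 328 : ℝ))) :=
    g2.trans (div_le_div_of_nonneg_right (hyθ _ (by norm_num)) (hden _ (by norm_num)).le)
  have g4' : ∑ k ∈ Finset.range K, (geomBlock x₀ ρ (k + 1) : ℝ) ^ (-(23 / 123 : ℝ))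
      ≤ Zθ ^ (-(23 / 123 : ℝ)) / (1 - ρ ^ (-(23 / 123 : ℝ))) :=
    g4.trans (div_le_div_of_nonneg_right (hyθ _ (by norm_num)) (hden _ (by norm_num)).le)
  have g5' : ∑ k ∈ Finset.range K, (geomBlock x₀ ρ (k + 1) : ℝ) ^ (-(1 / 41 : ℝ))
      ≤ Zθ ^ (-(1 / 41 : ℝ)) / (1 - ρ ^ (-(1 / 41 : ℝ))) :=
    g5.trans (div_le_div_of_nonneg_right (hyθ _ (by norm_num)) (hden _ (by norm_num)).le)
  have c1 : 0 ≤ α * S1 * t ^ (11 / 82 : ℝ) := by positivity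
  have c2 : 0 ≤ α * S2 * t ^ (61 / 328 : ℝ) := by positivity
  have c0 : 0 ≤ α * S0 * t ^ (-(15 / 82 : ℝ)) := by positivity
  have c4 : 0 ≤ α * S4 * t ^ (5 / 41 : ℝ) := by positivity
  have c5 : 0 ≤ α * S5 * t ^ (6 / 41 : ℝ) := by positivity
  have m1 := mul_le_mul_of_nonneg_left g1 c1
  have m2 := mul_le_mul_of_nonneg_left g2' c2
  have m0 := mul_le_mul_of_nonneg_left g0 c0
  have m4 := mul_le_mul_of_nonneg_left g4' c4
  have m5 := mul_le_mul_of_nonneg_left g5' c5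
  have e : α * S3 * (K : ℝ) = (K : ℝ) * (α * S3) := by ring
  nlinarith [m1, m2, m0, m4, m5, e]

/-! ### The middle range (Patel–Yang, Lemma 3.3 summed) -/

/-- **The middle range summed over its blocks**: with `Y > 0`, `2ρ ≤ M₀ ≤ Y`,
`K = ⌈log(Y/M₀)/log ρ⌉`, `a_k = ⌊Yρ^{-k}⌋` and `ρ(1 + 1/(M₀/ρ - 1)) ≤ H`:
`‖∑_{a_K<n≤a_0} n^{-(1/2+it)}‖ ≤ D₃(H) t^{1/14} Y^{3/14}/(ρ^{3/14}-1) + D₄(H) t^{-1/14} Y^{15/28}/(ρ^{15/28}-1)`.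
[cite: PatelYang2024, Lemma 3.3] -/
theorem midRange_sum_le {t Y ρ H η M₀ : ℝ} (ht : 0 < t) (hY : 0 < Y) (hρ : 1 < ρ) (hM₀ : 2 * ρ ≤ M₀)
    (hMY : M₀ ≤ Y) (hH : ρ * (1 + 1 / (M₀ / ρ - 1)) ≤ H) (hη : 0 < η) :
    ‖∑ n ∈ Finset.Ioc (geomBlock Y ρ ⌈Real.log (Y / M₀) / Real.log ρ⌉₊) (geomBlock Y ρ 0),
        (n : ℂ) ^ (-((1 / 2 : ℂ) + t * Complex.I))‖
      ≤ pyD3 H η * t ^ (1 / 14 : ℝ) * (Y ^ (3 / 14 : ℝ) / (ρ ^ (3 / 14 : ℝ) - 1))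
        + pyD4 H η * t ^ (-(1 / 14 : ℝ)) * (Y ^ (15 / 28 : ℝ) / (ρ ^ (15 / 28 : ℝ) - 1)) := by
  set K : ℕ := ⌈Real.log (Y / M₀) / Real.log ρ⌉₊ with hK
  have hρ0 : 0 < ρ := by linarith
  have hρ1 : 1 ≤ ρ := hρ.le
  have hM₀0 : 0 < M₀ := by linarith
  have hyK : M₀ / ρ < geomSeq Y ρ K := geomSeq_ceilLog_gt hM₀0 hMY hρ
  have hMρ : 2 ≤ M₀ / ρ := by rw [le_div_iff₀ hρ0]; linarith
  have hyK1 : 1 < geomSeq Y ρ K := by linarith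
  have hH1 : 1 < H := by
    have h1 : 0 < 1 / (M₀ / ρ - 1) := by apply one_div_pos.2; linarith
    nlinarith
  have hD3 := pyD3_nonneg hH1 hη
  have hD4 := pyD4_nonneg hH1 hη
  have hblock : ∀ k ∈ Finset.range K,
      ‖∑ n ∈ Finset.Ioc (geomBlock Y ρ (k + 1)) (geomBlock Y ρ k), (n : ℂ) ^ (-((1 / 2 : ℂ) + t * Complex.I))‖
        ≤ pyD3 H η * t ^ (1 / 14 : ℝ) * (geomBlock Y ρ (k + 1) : ℝ) ^ (3 / 14 : ℝ)
          + pyD4 H η * t ^ (-(1 / 14 : ℝ)) * (geomBlock Y ρ (k + 1) : ℝ) ^ (15 / 28 : ℝ) := by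
    intro k hk
    rw [Finset.mem_range] at hk
    have hage : geomSeq Y ρ K - 1 ≤ geomBlock Y ρ (k + 1) := geomBlock_succ_ge hY.le hρ1 hk
    have ha1 : 1 ≤ geomBlock Y ρ (k + 1) := by
      have : (1 : ℝ) ≤ geomBlock Y ρ (k + 1) := by linarith
      exact_mod_cast this
    have hratio := geomBlock_ratio_le hY.le hρ1 hk hyK1
    have hb : (geomBlock Y ρ k : ℝ) ≤ H * geomBlock Y ρ (k + 1) := by
      refine hratio.trans (mul_le_mul_of_nonneg_right ?_ (Nat.cast_nonneg _))
      refine le_trans ?_ hH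
      refine mul_le_mul_of_nonneg_left ?_ hρ0.le
      have : 1 / (geomSeq Y ρ K - 1) ≤ 1 / (M₀ / ρ - 1) :=
        one_div_le_one_div_of_le (by linarith) (by linarith)
      linarith
    have h := midBlock_phi_le' (η := η) ht hH1 hη ha1 hb
    refine h.trans (le_of_eq ?_)
    ring
  refine (norm_sum_Ioc_telescope_le _ (fun k => geomBlock_antitone hY.le hρ1 (Nat.le_succ k)) K).trans ?_
  refine (Finset.sum_le_sum hblock).trans ?_
  simp only [Finset.sum_add_distrib, ← Finset.mul_sum]
  have g1 := sum_geomBlock_rpow_le_of_pos (x := 3 / 14) hY.le hρ (by norm_num) K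
  have g2 := sum_geomBlock_rpow_le_of_pos (x := 15 / 28) hY.le hρ (by norm_num) K
  have c1 : 0 ≤ pyD3 H η * t ^ (1 / 14 : ℝ) := by positivity
  have c2 : 0 ≤ pyD4 H η * t ^ (-(1 / 14 : ℝ)) := by positivity
  exact add_le_add (mul_le_mul_of_nonneg_left g1 c1) (mul_le_mul_of_nonneg_left g2 c2)

/-- The last middle-range block boundary is at most `M₀`. [folklore] -/
theorem geomBlock_ceilLog_le {Y ρ M₀ : ℝ} (hY : 0 < Y) (hρ : 1 < ρ) (hM₀ : 0 < M₀) :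
    (geomBlock Y ρ ⌈Real.log (Y / M₀) / Real.log ρ⌉₊ : ℝ) ≤ M₀ :=
  (geomBlock_le hY.le (by linarith) _).trans (geomSeq_ceilLog_le hY hM₀ hρ)

/-- `a_0 = ⌊Y⌋`. [folklore] -/
theorem geomBlock_zero (Y ρ : ℝ) : geomBlock Y ρ 0 = ⌊Y⌋₊ := by simp [geomBlock]


/-! ### The Riemann–Siegel starting point and the three-range decomposition -/

open SiegelIntegral in
/-- **Riemann–Siegel start** (as in the tree's proof of Lehman's bound): for `t ≥ 128π`,
`‖ζ(½ + it)‖ ≤ 2‖∑_{n ≤ ⌊√(t/2π)⌋} n^{-(1/2+it)}‖ + 2·(√2·¾)`. [cite: Siegel1932, §3 eqs. (59)–(60)] -/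
theorem norm_zeta_half_le_main_sum {t : ℝ} (ht : 128 * π ≤ t) :
    ‖riemannZeta (1 / 2 + t * Complex.I)‖
      ≤ 2 * ‖∑ n ∈ Finset.Icc 1 ⌊Real.sqrt (t / (2 * π))⌋₊, (n : ℂ) ^ (-((1 / 2 : ℂ) + t * Complex.I))‖
        + 2 * (Real.sqrt 2 * (3 / 4)) := by
  have hπ := Real.pi_pos
  have hπ3 : 3.1415 < π := Real.pi_gt_d4
  have ht0 : 0 < t := by nlinarith
  set x₀ : ℝ := Real.sqrt (t / (2 * π)) with hx₀def
  have hx₀sq : x₀ ^ 2 = t / (2 * π) := by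
    rw [hx₀def]; exact Real.sq_sqrt (div_nonneg ht0.le (by positivity))
  have ht' : t = 2 * π * x₀ ^ 2 := by rw [hx₀sq]; field_simp
  have hx₀ : 8 ≤ x₀ := by
    rw [hx₀def, Real.le_sqrt (by norm_num) (div_nonneg ht0.le (by positivity))]
    rw [le_div_iff₀ (by positivity)]; nlinarith
  set N : ℕ := ⌊x₀⌋₊ with hNdef
  set c : ℝ := max ((N : ℝ) + 1 / 4) (min x₀ (N + 3 / 4)) with hcdef
  obtain ⟨hN8, hc1, hc2, hδ, hd, _⟩ := clamp_props hx₀ hNdef hcdef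
  set s : ℂ := 1 / 2 + t * Complex.I with hsdef
  have h1 := norm_riemannZeta_half_le_two_mul t
  have h2 := riemannAux_eq_sum_add_rsLineIntegral s (N := N) (by omega) (c := c) (by linarith) (by linarith)
  have hJ : ‖rsLineIntegral c s‖ ≤ Real.sqrt 2 * (3 / 4) := by
    rw [rsLineIntegral, norm_mul, norm_neg]
    have hn : ‖(1 : ℂ) + Complex.I‖ = Real.sqrt 2 := by
      have := Complex.norm_add_mul_I 1 1
      simp only [Complex.ofReal_one, one_mul] at this
      rw [this]; norm_num
    rw [hn]
    refine mul_le_mul_of_nonneg_left ?_ (Real.sqrt_nonneg _)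
    exact (MeasureTheory.norm_integral_le_integral_norm _).trans (integral_norm_rsKernel_le ht' hx₀ hδ hd)
  have hR : ‖riemannAux s‖ ≤ ‖∑ n ∈ Finset.Icc 1 N, ((n : ℂ)) ^ (-s)‖ + Real.sqrt 2 * (3 / 4) := by
    rw [h2]; exact (norm_add_le _ _).trans (add_le_add le_rfl hJ)
  calc ‖riemannZeta (1 / 2 + t * Complex.I)‖ ≤ 2 * ‖riemannAux s‖ := h1
    _ ≤ 2 * (‖∑ n ∈ Finset.Icc 1 N, ((n : ℂ)) ^ (-s)‖ + Real.sqrt 2 * (3 / 4)) := by linarith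
    _ = _ := by ring

/-- **The three-range decomposition** (Patel–Yang (3.4)–(3.6), Lemmas 3.2, 3.3, 3.5 combined with
our constants): for `t ≥ max(t₀, 128π)` and parameters as displayed,
`‖ζ(½+it)‖ ≤ 2(2√M₀ + MID(t) + TOP(t)) + 2(√2·¾)`. [cite: PatelYang2024, §3.6] -/
theorem norm_zeta_half_le_blocks {t t₀ ρ₁ H₁ η₁ θ₁ θ₂ ρ₂ H₂ η₂ M₀ : ℝ} (ht₀ : 0 < t₀) (ht : t₀ ≤ t)
    (ht128 : 128 * π ≤ t) (hρ₁ : 1 < ρ₁) (hH₁ : ρ₁ * (1 + 1 / (θ₂ * t ^ (7 / 17 : ℝ))) ≤ H₁)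
    (hη₁ : 0 < η₁) (hθ₁ : 0 < θ₁) (hθ₂ : 0 < θ₂) (hZ1 : 1 ≤ θ₂ * t ^ (7 / 17 : ℝ))
    (hZx : θ₂ * t ^ (7 / 17 : ℝ) + 1 ≤ Real.sqrt (t / (2 * π)))
    (hρ₂ : 1 < ρ₂) (hM₀ : 2 * ρ₂ ≤ M₀) (hM₀Z : M₀ ≤ θ₂ * t ^ (7 / 17 : ℝ) + 1)
    (hH₂ : ρ₂ * (1 + 1 / (M₀ / ρ₂ - 1)) ≤ H₂) (hη₂ : 0 < η₂) :
    ‖riemannZeta (1 / 2 + t * Complex.I)‖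
      ≤ 2 * (2 * Real.sqrt M₀
          + (pyD3 H₂ η₂ * t ^ (1 / 14 : ℝ)
              * ((ρ₁ * (θ₂ * t ^ (7 / 17 : ℝ) + 1)) ^ (3 / 14 : ℝ) / (ρ₂ ^ (3 / 14 : ℝ) - 1))
            + pyD4 H₂ η₂ * t ^ (-(1 / 14 : ℝ))
              * ((ρ₁ * (θ₂ * t ^ (7 / 17 : ℝ) + 1)) ^ (15 / 28 : ℝ) / (ρ₂ ^ (15 / 28 : ℝ) - 1)))
          + pyAlpha H₁ θ₁ θ₂ t₀ *
            (pySK1 H₁ η₁ θ₁ θ₂ t₀ * t ^ (11 / 82 : ℝ)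
                * ((Real.sqrt (t / (2 * π))) ^ (5 / 82 : ℝ) / (ρ₁ ^ (5 / 82 : ℝ) - 1))
            + pySK2 H₁ η₁ θ₁ θ₂ t₀ * t ^ (61 / 328 : ℝ)
                * ((θ₂ * t ^ (7 / 17 : ℝ)) ^ (-(17 / 328 : ℝ)) / (1 - ρ₁ ^ (-(17 / 328 : ℝ))))
            + pySK0 H₁ θ₁ * t ^ (-(15 / 82 : ℝ))
                * ((Real.sqrt (t / (2 * π))) ^ (87 / 164 : ℝ) / (ρ₁ ^ (87 / 164 : ℝ) - 1))
            + pySK3 H₁ * ⌊Real.log (Real.sqrt (t / (2 * π)) / (θ₂ * t ^ (7 / 17 : ℝ) + 1)) / Real.log ρ₁⌋₊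
            + pySK4 H₁ θ₁ θ₂ t₀ * t ^ (5 / 41 : ℝ)
                * ((θ₂ * t ^ (7 / 17 : ℝ)) ^ (-(23 / 123 : ℝ)) / (1 - ρ₁ ^ (-(23 / 123 : ℝ))))
            + pySK5 H₁ θ₁ θ₂ t₀ * t ^ (6 / 41 : ℝ)
                * ((θ₂ * t ^ (7 / 17 : ℝ)) ^ (-(1 / 41 : ℝ)) / (1 - ρ₁ ^ (-(1 / 41 : ℝ))))))
        + 2 * (Real.sqrt 2 * (3 / 4)) := by
  have ht0 : 0 < t := ht₀.trans_le ht
  set x₀ : ℝ := Real.sqrt (t / (2 * π)) with hx₀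
  set Zθ : ℝ := θ₂ * t ^ (7 / 17 : ℝ) with hZθ
  have hx₀0 : 0 ≤ x₀ := Real.sqrt_nonneg _
  have hZθ0 : 0 < Zθ := by positivity
  -- the top blocks
  set K₁ : ℕ := ⌊Real.log (x₀ / (Zθ + 1)) / Real.log ρ₁⌋₊ with hK₁
  set Y₂ : ℝ := geomSeq x₀ ρ₁ K₁ with hY₂
  have hY₂Z : Zθ + 1 ≤ Y₂ := geomSeq_floorLog_ge (by linarith) hZx hρ₁
  have hY₂lt : Y₂ < ρ₁ * (Zθ + 1) := geomSeq_floorLog_lt (by linarith) hZx hρ₁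
  have hY₂0 : 0 < Y₂ := by linarith
  have hMY : M₀ ≤ Y₂ := hM₀Z.trans hY₂Z
  -- the middle blocks
  set K₂ : ℕ := ⌈Real.log (Y₂ / M₀) / Real.log ρ₂⌉₊ with hK₂
  have hM₀0 : 0 < M₀ := by linarith
  -- block boundaries
  have hN : ⌊x₀⌋₊ = geomBlock x₀ ρ₁ 0 := (geomBlock_zero x₀ ρ₁).symm
  have hJ : geomBlock x₀ ρ₁ K₁ = geomBlock Y₂ ρ₂ 0 := by rw [geomBlock_zero]; rfl
  have hmono₁ : geomBlock x₀ ρ₁ K₁ ≤ geomBlock x₀ ρ₁ 0 := geomBlock_antitone hx₀0 hρ₁.le (Nat.zero_le _)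
  have hmono₂ : geomBlock Y₂ ρ₂ K₂ ≤ geomBlock Y₂ ρ₂ 0 := geomBlock_antitone hY₂0.le hρ₂.le (Nat.zero_le _)
  -- the pieces
  have hTop := topRange_sum_le (η := η₁) ht₀ ht hρ₁ hH₁ hη₁ hθ₁ hθ₂ hZ1 hZx
  have hMid := midRange_sum_le (t := t) (η := η₂) ht0 hY₂0 hρ₂ hM₀ hMY hH₂ hη₂
  have hInit := initial_cpow_le t (geomBlock Y₂ ρ₂ K₂)
  have hInit' : 2 * Real.sqrt (geomBlock Y₂ ρ₂ K₂ : ℝ) ≤ 2 * Real.sqrt M₀ :=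
    mul_le_mul_of_nonneg_left (Real.sqrt_le_sqrt (geomBlock_ceilLog_le hY₂0 hρ₂ hM₀0)) (by norm_num)
  -- monotone replacement `Y₂ ≤ ρ₁ (Zθ + 1)` in the middle-range bound
  have hH₂1 : 1 < H₂ := by
    have hρ0 : 0 < ρ₂ := by linarith
    have hMρ : 2 ≤ M₀ / ρ₂ := by rw [le_div_iff₀ hρ0]; linarith
    have h1 : 0 < 1 / (M₀ / ρ₂ - 1) := by apply one_div_pos.2; linarith
    nlinarith
  have hD3 := pyD3_nonneg hH₂1 hη₂
  have hD4 := pyD4_nonneg hH₂1 hη₂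
  have hρ₂d1 : 0 < ρ₂ ^ (3 / 14 : ℝ) - 1 := by linarith [Real.one_lt_rpow hρ₂ (by norm_num : (0:ℝ) < 3 / 14)]
  have hρ₂d2 : 0 < ρ₂ ^ (15 / 28 : ℝ) - 1 := by linarith [Real.one_lt_rpow hρ₂ (by norm_num : (0:ℝ) < 15 / 28)]
  have hY1 : Y₂ ^ (3 / 14 : ℝ) ≤ (ρ₁ * (Zθ + 1)) ^ (3 / 14 : ℝ) :=
    Real.rpow_le_rpow hY₂0.le hY₂lt.le (by norm_num)
  have hY2 : Y₂ ^ (15 / 28 : ℝ) ≤ (ρ₁ * (Zθ + 1)) ^ (15 / 28 : ℝ) :=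
    Real.rpow_le_rpow hY₂0.le hY₂lt.le (by norm_num)
  have hMid' : pyD3 H₂ η₂ * t ^ (1 / 14 : ℝ) * (Y₂ ^ (3 / 14 : ℝ) / (ρ₂ ^ (3 / 14 : ℝ) - 1))
        + pyD4 H₂ η₂ * t ^ (-(1 / 14 : ℝ)) * (Y₂ ^ (15 / 28 : ℝ) / (ρ₂ ^ (15 / 28 : ℝ) - 1))
      ≤ pyD3 H₂ η₂ * t ^ (1 / 14 : ℝ) * ((ρ₁ * (Zθ + 1)) ^ (3 / 14 : ℝ) / (ρ₂ ^ (3 / 14 : ℝ) - 1))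
        + pyD4 H₂ η₂ * t ^ (-(1 / 14 : ℝ)) * ((ρ₁ * (Zθ + 1)) ^ (15 / 28 : ℝ) / (ρ₂ ^ (15 / 28 : ℝ) - 1)) := by
    gcongr
  -- assemble the main sum
  have hmain : ‖∑ n ∈ Finset.Icc 1 ⌊x₀⌋₊, (n : ℂ) ^ (-((1 / 2 : ℂ) + t * Complex.I))‖
      ≤ 2 * Real.sqrt M₀
        + (pyD3 H₂ η₂ * t ^ (1 / 14 : ℝ) * ((ρ₁ * (Zθ + 1)) ^ (3 / 14 : ℝ) / (ρ₂ ^ (3 / 14 : ℝ) - 1))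
          + pyD4 H₂ η₂ * t ^ (-(1 / 14 : ℝ)) * ((ρ₁ * (Zθ + 1)) ^ (15 / 28 : ℝ) / (ρ₂ ^ (15 / 28 : ℝ) - 1)))
        + pyAlpha H₁ θ₁ θ₂ t₀ *
          (pySK1 H₁ η₁ θ₁ θ₂ t₀ * t ^ (11 / 82 : ℝ) * (x₀ ^ (5 / 82 : ℝ) / (ρ₁ ^ (5 / 82 : ℝ) - 1))
          + pySK2 H₁ η₁ θ₁ θ₂ t₀ * t ^ (61 / 328 : ℝ) * (Zθ ^ (-(17 / 328 : ℝ)) / (1 - ρ₁ ^ (-(17 / 328 : ℝ))))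
          + pySK0 H₁ θ₁ * t ^ (-(15 / 82 : ℝ)) * (x₀ ^ (87 / 164 : ℝ) / (ρ₁ ^ (87 / 164 : ℝ) - 1))
          + pySK3 H₁ * K₁
          + pySK4 H₁ θ₁ θ₂ t₀ * t ^ (5 / 41 : ℝ) * (Zθ ^ (-(23 / 123 : ℝ)) / (1 - ρ₁ ^ (-(23 / 123 : ℝ))))
          + pySK5 H₁ θ₁ θ₂ t₀ * t ^ (6 / 41 : ℝ) * (Zθ ^ (-(1 / 41 : ℝ)) / (1 - ρ₁ ^ (-(1 / 41 : ℝ))))) := by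
    rw [hN]
    refine (norm_sum_Icc_split_le _ hmono₁).trans ?_
    have h2 := norm_sum_Icc_split_le (fun n : ℕ => (n : ℂ) ^ (-((1 / 2 : ℂ) + t * Complex.I))) hmono₂
    rw [← hJ] at h2
    rw [← hK₂, ← hJ] at hMid
    rw [← hx₀, ← hZθ] at hTop
    rw [← hK₁] at hTop
    linarith [h2, hMid, hMid', hInit, hInit', hTop]
  have hRS := norm_zeta_half_le_main_sum ht128
  linarith [hmain, hRS]


end VdC
end Literature.NumberTheory.LFunctions
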